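import Mathlib
import Summits.NavierStokesRegularity.NavierStokesRegularity.Theorems.LerayQuarterDissipationFiniteDissipationLiouvilleVelocityLSix
import Literature.Analysis.FluidPDE.SobolevWholeSpaceLSix
import HarnessLib

/-!
# Crux `FiniteDissipationLiouville` (stmt-NavierStokesRegularity-22144): the `L⁶`-velocity constant
# is bounded by the dissipation constant, `V₆ ≤ KS·√K`, and lead g14's explicit small-dissipation rung
# `θ(K)⁴ < 64/27 ⇒ V ≡ 0` is a COROLLARY of the `L⁶`-velocity rung (the "Sobolev shadow", made formal)

Theorems file of route `LerayQuarterDissipation` (lead prover g16; `--supports` the crux; sequel of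
`…VelocityLSix` using the Literature lemma
`Literature.Analysis.FluidPDE.eLpNorm_six_le_eLpNorm_fderiv_two_of_eLpNorm_six_lt_top` — the
Gagliardo–Nirenberg–Sobolev inequality for fields that are merely in `L⁶`, landed for this purpose).
Navier–Stokes regularity is NOT proved by anything here; no summit is.

* `integral_pow_six_le_of_integrable_six` — integral form of the `L⁶`-hypothesis GNS inequality in
  dimension three: `C¹`, `‖u‖⁶ ∈ L¹`, `‖Du‖² ∈ L¹` ⇒ `∫‖u‖⁶ ≤ (KS·√∫‖Du‖²)⁶` (no `L²` hypothesis on `u`);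
* `integral_pow_six_norm_lerayOrbit_le` — **on the stratum `𝒟_{C,K}`: `∫‖U(s)‖⁶ ≤ (KS·√(max K 0))⁶`
  for every similarity time**, i.e. `V₆ = sup_t (−t)^{1/4}‖V(t)‖_{L⁶} ≤ KS·√(max K 0)` — the fifth
  parameter is finite with an EXPLICIT bound (the tree's `…SliceLSix.memLp_six_slice` had an
  existential constant);
* **`eq_zero_of_small_dissipation_via_velocityLSix`** — `KS⁶(max K 0)² < 64/27 ⇒ V ≡ 0` DERIVED from
  `…VelocityLSix.lerayVorticity_eq_zero_of_pow_six_le` with `w = KS√(max K 0)` (`KS²w⁴ = KS⁶(max K 0)²`):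
  the statement of lead g14's `…SmallDissipationGap.eq_zero_of_small_dissipation_sharper`
  (`(√(max K 0)·KS^{3/2})⁴ < 64/27`), now literally a special case of the velocity-integrability rung.

HONEST FRAMING. Bookkeeping making a structural remark formal; Mathlib's non-sharp constant; nothing
is removed from the catalogued DSS wall; nothing here bears on Navier–Stokes regularity or blow-up.
References: Evans 2010 §5.6.1; Ladyzhenskaya 1969; folklore.
-/

noncomputable section

set_option linter.dupNamespace false

namespace Summit.NavierStokesRegularity.NavierStokesRegularity.Theorems.FiniteDissipationLiouville.VelocityLSix

open MeasureTheory Set Filter Topology Metric InnerProductSpace Function Real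
open scoped RealInnerProductSpace ContDiff ENNReal
open Literature.Analysis Literature.Analysis.FluidPDE
open Summit.NavierStokesRegularity.NavierStokesRegularity.Theorems
open Summit.NavierStokesRegularity.NavierStokesRegularity.Theorems.GaussianGap
open Summit.NavierStokesRegularity.NavierStokesRegularity.Theorems.SimilarityEnstrophy
open Summit.NavierStokesRegularity.NavierStokesRegularity.Theorems.SmallDissipationGap
open Summit.NavierStokesRegularity.NavierStokesRegularity.Theorems.FiniteDissipationLiouville.VorticityAmplitude
open Summit.NavierStokesRegularity.NavierStokesRegularity.Theorems.FiniteDissipationLiouville.VorticityLThree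

variable {C : ℝ} {V : ℝ → (EuclideanSpace ℝ (Fin 3)) → (EuclideanSpace ℝ (Fin 3))}

/-- **`∫‖u‖⁶ ≤ (KS·√∫‖Du‖²)⁶` for `C¹` fields with `‖u‖⁶, ‖Du‖² ∈ L¹`** (dimension three; NO `L²`
hypothesis on `u`): the integral form of
`Literature.Analysis.FluidPDE.eLpNorm_six_le_eLpNorm_fderiv_two_of_eLpNorm_six_lt_top` (the tree's
`integral_norm_pow_six_le_of_integrable` with its `L²` hypothesis removed). [cite: Evans2010, §5.6.1 Thm. 1–2] -/
theorem integral_pow_six_le_of_integrable_six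
    {u : EuclideanSpace ℝ (Fin 3) → EuclideanSpace ℝ (Fin 3)} (hu : ContDiff ℝ 1 u)
    (h6 : Integrable fun x => ‖u x‖ ^ 6) (hD : Integrable fun x => ‖fderiv ℝ u x‖ ^ 2) :
    ∫ x, ‖u x‖ ^ 6 ≤ ((SNormLESNormFDerivOfEqConst (EuclideanSpace ℝ (Fin 3))
        (volume : Measure (EuclideanSpace ℝ (Fin 3))) 2 : ℝ) * Real.sqrt (∫ x, ‖fderiv ℝ u x‖ ^ 2)) ^ 6 := by
  set K₀ : NNReal := SNormLESNormFDerivOfEqConst (EuclideanSpace ℝ (Fin 3))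
    (volume : Measure (EuclideanSpace ℝ (Fin 3))) 2 with hK₀
  have huc : Continuous u := hu.continuous
  have hDc : Continuous (fderiv ℝ u) := hu.continuous_fderiv one_ne_zero
  have hm6 : MemLp u 6 volume := by
    refine (integrable_norm_rpow_iff huc.aestronglyMeasurable (by norm_num) (by norm_num)).1 ?_
    refine h6.congr (ae_of_all _ fun x => ?_)
    simp only [ENNReal.toReal_ofNat]
    rw [show (6 : ℝ) = ((6 : ℕ) : ℝ) by norm_num, Real.rpow_natCast]
  have hmD : MemLp (fderiv ℝ u) 2 volume :=
    (memLp_two_iff_integrable_sq_norm hDc.aestronglyMeasurable).2 hD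
  have hsob := eLpNorm_six_le_eLpNorm_fderiv_two_of_eLpNorm_six_lt_top
    (volume : Measure (EuclideanSpace ℝ (Fin 3))) finrank_euclideanSpace_fin hu hm6.eLpNorm_lt_top
  set I6 : ℝ := ∫ x, ‖u x‖ ^ 6 with hI6
  set B : ℝ := ∫ x, ‖fderiv ℝ u x‖ ^ 2 with hB
  have hI60 : 0 ≤ I6 := integral_nonneg fun x => by positivity
  have e6 : eLpNorm u 6 volume = ENNReal.ofReal (I6 ^ ((6 : ℝ)⁻¹)) := by
    rw [MemLp.eLpNorm_eq_integral_rpow_norm (by norm_num) (by norm_num) hm6, ENNReal.toReal_ofNat]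
    have hint : ∫ x, ‖u x‖ ^ (6 : ℝ) = I6 := integral_congr_ae (ae_of_all _ fun x => by
      show ‖u x‖ ^ (6 : ℝ) = ‖u x‖ ^ 6
      rw [show (6 : ℝ) = ((6 : ℕ) : ℝ) by norm_num, Real.rpow_natCast])
    simp only [hint]
  have e2 : eLpNorm (fderiv ℝ u) 2 volume = ENNReal.ofReal (Real.sqrt B) := by
    rw [MemLp.eLpNorm_eq_integral_rpow_norm (by norm_num) (by norm_num) hmD, ENNReal.toReal_ofNat]
    have hint : ∫ x, ‖fderiv ℝ u x‖ ^ (2 : ℝ) = B := integral_congr_ae (ae_of_all _ fun x => by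
      show ‖fderiv ℝ u x‖ ^ (2 : ℝ) = ‖fderiv ℝ u x‖ ^ 2
      rw [Real.rpow_two])
    rw [hint, Real.sqrt_eq_rpow, one_div]
  rw [e6, e2, ← ENNReal.ofReal_coe_nnreal, ← ENNReal.ofReal_mul (NNReal.coe_nonneg _)] at hsob
  have hle : I6 ^ ((6 : ℝ)⁻¹) ≤ (K₀ : ℝ) * Real.sqrt B :=
    (ENNReal.ofReal_le_ofReal_iff (by positivity)).1 hsob
  have h := pow_le_pow_left₀ (Real.rpow_nonneg hI60 _) hle 6
  have hid : (I6 ^ ((6 : ℝ)⁻¹)) ^ (6 : ℕ) = I6 := by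
    rw [← Real.rpow_natCast, ← Real.rpow_mul hI60]; norm_num
  rwa [hid] at h

/-- **`V₆ ≤ KS·√(max K 0)` on the stratum**: for `V ∈ 𝒟_{C,K}` every similarity slice has
`∫‖U(s)‖⁶ ≤ (KS·√(max K 0))⁶` (the slice is `C¹`, in `L⁶` by `…VorticityAmplitude.integrable_pow_six_norm_lerayOrbit`,
with `∫‖DU(s)‖² ≤ max K 0` by `…SmallDissipationGap.integrable_sq_norm_fderiv_lerayOrbit`). [folklore] -/
theorem integral_pow_six_norm_lerayOrbit_le (hV : IsTypeIAncientMild C V) {K : ℝ}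
    (hK : ∀ t : ℝ, t < 0 → ∫⁻ x, ‖fderiv ℝ (V t) x‖ₑ ^ 2 ≤ ENNReal.ofReal (K / Real.sqrt (-t)))
    (s : ℝ) :
    ∫ y, ‖lerayOrbit V s y‖ ^ 6 ≤ ((SNormLESNormFDerivOfEqConst (EuclideanSpace ℝ (Fin 3))
        (volume : Measure (EuclideanSpace ℝ (Fin 3))) 2 : ℝ) * Real.sqrt (max K 0)) ^ 6 := by
  have hKS0 : 0 ≤ (SNormLESNormFDerivOfEqConst (EuclideanSpace ℝ (Fin 3))
        (volume : Measure (EuclideanSpace ℝ (Fin 3))) 2 : ℝ) := NNReal.coe_nonneg _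
  obtain ⟨hint, hle⟩ := integrable_sq_norm_fderiv_lerayOrbit hV hK s
  have h6 := integrable_pow_six_norm_lerayOrbit hV hK s
  have hU1 : ContDiff ℝ 1 (lerayOrbit V s) := mustSqueeze_contDiff_lerayOrbit_slice hV s (n := 1)
  calc ∫ y, ‖lerayOrbit V s y‖ ^ 6
      ≤ ((SNormLESNormFDerivOfEqConst (EuclideanSpace ℝ (Fin 3))
        (volume : Measure (EuclideanSpace ℝ (Fin 3))) 2 : ℝ) * Real.sqrt (∫ y, ‖fderiv ℝ (lerayOrbit V s) y‖ ^ 2)) ^ 6 :=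
        integral_pow_six_le_of_integrable_six hU1 h6 hint
    _ ≤ ((SNormLESNormFDerivOfEqConst (EuclideanSpace ℝ (Fin 3))
        (volume : Measure (EuclideanSpace ℝ (Fin 3))) 2 : ℝ) * Real.sqrt (max K 0)) ^ 6 := by
        gcongr

/-- **Lead g14's sharper small-dissipation rung as a corollary of the `L⁶`-velocity rung.** A member
of `𝒟_{C,K}` (any `C`) with `KS⁶·(max K 0)² < 64/27` — the hypothesis
`(√(max K 0)·KS^{3/2})⁴ < 64/27` of `…SmallDissipationGap.eq_zero_of_small_dissipation_sharper` —
vanishes identically on `t < 0`: take `w = KS·√(max K 0)` in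
`lerayVorticity_eq_zero_of_pow_six_le` (`KS²w⁴ = KS⁶(max K 0)²`). [folklore energy method] -/
theorem eq_zero_of_small_dissipation_via_velocityLSix (hV : IsTypeIAncientMild C V) {K : ℝ}
    (hK : ∀ t : ℝ, t < 0 → ∫⁻ x, ‖fderiv ℝ (V t) x‖ₑ ^ 2 ≤ ENNReal.ofReal (K / Real.sqrt (-t)))
    (hθ : (SNormLESNormFDerivOfEqConst (EuclideanSpace ℝ (Fin 3))
        (volume : Measure (EuclideanSpace ℝ (Fin 3))) 2 : ℝ) ^ 6 * (max K 0) ^ 2 < 64 / 27) :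
    ∀ t < 0, ∀ x, V t x = 0 := by
  have hKS0 : 0 ≤ (SNormLESNormFDerivOfEqConst (EuclideanSpace ℝ (Fin 3))
        (volume : Measure (EuclideanSpace ℝ (Fin 3))) 2 : ℝ) := NNReal.coe_nonneg _
  have hK0 : 0 ≤ max K 0 := le_max_right _ _
  set w : ℝ := (SNormLESNormFDerivOfEqConst (EuclideanSpace ℝ (Fin 3))
        (volume : Measure (EuclideanSpace ℝ (Fin 3))) 2 : ℝ) * Real.sqrt (max K 0) with hwdef
  have hw : 0 ≤ w := mul_nonneg hKS0 (Real.sqrt_nonneg _)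
  have hq : (SNormLESNormFDerivOfEqConst (EuclideanSpace ℝ (Fin 3))
        (volume : Measure (EuclideanSpace ℝ (Fin 3))) 2 : ℝ) ^ 2 * w ^ 4 < 64 / 27 := by
    have e : (SNormLESNormFDerivOfEqConst (EuclideanSpace ℝ (Fin 3))
        (volume : Measure (EuclideanSpace ℝ (Fin 3))) 2 : ℝ) ^ 2 * w ^ 4 = (SNormLESNormFDerivOfEqConst (EuclideanSpace ℝ (Fin 3))
        (volume : Measure (EuclideanSpace ℝ (Fin 3))) 2 : ℝ) ^ 6 * (max K 0) ^ 2 := by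
      rw [hwdef, mul_pow, show Real.sqrt (max K 0) ^ 4 = (Real.sqrt (max K 0) ^ 2) ^ 2 by ring,
        Real.sq_sqrt hK0]
      ring
    rwa [e]
  exact eq_zero_of_lerayVorticity_eq_zero hV (lerayVorticity_eq_zero_of_pow_six_le hV hK hw hq
    fun σ => ⟨integrable_pow_six_norm_lerayOrbit hV hK σ, integral_pow_six_norm_lerayOrbit_le hV hK σ⟩)

end Summit.NavierStokesRegularity.NavierStokesRegularity.Theorems.FiniteDissipationLiouville.VelocityLSix

end
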